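/-
Copyright (c) 2026 the pub-hodgecm-mathlib formalisation cell (harness21).  Prover seat hodgecm-mathlib-K2Liu-p06 (g3): Track B «K2-LIT»,
hLiu418 = stmt-HodgeConjecture-24832; LEAD F0P6-plan (g12) 07:40:43Z «GO (Φ7-1)» item (iii); 2026-09-04.
-/
import Summits.HodgeConjecture.HodgeConjecture.Theorems.K2LiuSiegelEisensteinCoeffRestOrbits   -- ★ orbit regrouping of the middle term
import HarnessLib

/-!
# Crux `HLiu418`, ROAD Φ, organ Φ7-1 (iii): THE MIDDLE TERM CONCENTRATES ON ONE ORBIT — if every middle orbit other than `O(q₀)` dies,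
# `MID_S(h) = Σ'_{q ∈ O(q₀)} ∫ β(u) conj ψ_S(u) f(γ_q u h) dνN(u)`

Cell `hodgecm-mathlib`, crux item hLiu418 = `stmt-HodgeConjecture-24832`, route `HCCMUnconditional`; squad K2 ∕ K2Liu, LEAD F0P6-plan (g12) (07:40:43Z «GO (Φ7-1)»),
dealer K2E5-plan (g6), prover K2Liu-p06 (g3).  THEOREMS ONLY; lane `--supports stmt-HodgeConjecture-24832 --as helper` (count-neutral).

* **`integral_rest_eq_tsum_orbit`** — for ANY index `S`, a coset `q₀ ∈ REST` and the hypothesis that the orbit sum of every middle representative `w_χ p'`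
  whose orbit is NOT `O(q₀) = {[γ_{q₀} ν] : ν ∈ N_Δ(L⁺)}` vanishes, the middle term equals the sum over the single orbit `O(q₀)`:
  the regrouping of ★ `K2LiuSiegelEisensteinCoeffRestOrbits.integral_rest_eq_zero_of_forall_middle_orbit` (Fubini for series under (H), REST = ⊔ right
  `N_Δ(L⁺)`-orbits, `Summable.tsum_sigma'` over `Equiv.sigmaFiberEquiv`, ★ B2c face (X) + rational big cell for the representatives) closed by `tsum_eq_single`
  instead of `tsum_zero`.  With ★ `K2LiuSiegelEisensteinCoeffOrbitCriterion` (orbits die off the corner, sharply) this isolates the rank-`r` singular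
  coefficient on its surviving orbit (Φ7-1 (i)(ii): existence∕uniqueness of the corner-supported orbit; Φ7-2: its unfolding).  One `maxHeartbeats 400000`
  (documented, as in the ★ parent).
[KudlaRallis1994, §2], [Shimura1997, §18.3], [Tan1999, §3], [MoeglinWaldspurger1995, II.1.7].

HONEST LABEL.  Count-neutral helper; `HC_CM` is proved only modulo the 7 printed citations (2 remaining named inputs: hLiu418 = `stmt-HodgeConjecture-24832`,
h413 = `stmt-HodgeConjecture-24833`) until rung 0 closes.
-/

set_option autoImplicit false
set_option linter.dupNamespace false -- the mandated namespace repeats `HodgeConjecture.HodgeConjecture`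

noncomputable section

open scoped Matrix ENNReal NNReal ComplexConjugate
open NumberField IsDedekindDomain MeasureTheory MeasureTheory.Measure Filter Set Function
open Literature.NumberTheory.Automorphic Literature.NumberTheory.Automorphic.UnitaryGroup Literature.NumberTheory.GaloisRepresentations
open Literature.NumberTheory.GelbartRogawski1991 Literature.NumberTheory.GelbartRogawski1991.GRConstruction
open Literature.NumberTheory.K2Lit.SiegelDoubled Literature.MeasureTheory.Group
open UnitaryDualPair

namespace Summit.HodgeConjecture.HodgeConjecture.Cruxes.HLiu418.K2LiuSiegelEisensteinCoeffSingleOrbit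

open K2LiuUnipotentCoveringWeight K2LiuConstantTermBigCellUnfold K2LiuSiegelDoubledUnfold K2LiuSiegelUnipotentFourierDefs K2LiuSiegelUnipotentCharacters
  K2LiuSiegelFourierCoeffDelta K2LiuSiegelEisensteinCoeffCells K2LiuSiegelEisensteinCoeffOrbitSum K2LiuSiegelBruhatMiddleCellDelta
  K2LiuSiegelBruhatMiddleCellExhaustion K2LiuSiegelEisensteinCoeffMiddleOrbits K2LiuSiegelEisensteinCoeffNondegenerate

variable {L : Type} [Field L] [NumberField L] [IsCMField L]
variable {N M n : ℕ} {e : Fin N × Fin M ≃ Fin n}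
  {dV : Fin N → L} {hdV : ∀ i, IsCMField.complexConj L (dV i) = dV i}
  {dW : Fin M → L} {hdW : ∀ i, IsCMField.complexConj L (dW i) = dW i}

/-! ## §1 The middle term concentrates on one orbit -/

section Rest

variable (wq : unipDeltaRat L e dV hdV dW hdW → ratH L e dV hdV dW hdW)
  (hwq : ∀ ν, ((wq ν : ratH L e dV hdV dW hdW) : HA L e dV hdV dW hdW) =
    weylDelta L e dV hdV dW hdW * ((ν : unipDelta L e dV hdV dW hdW) : HA L e dV hdV dW hdW))

variable [MeasurableSpace (unipDelta L e dV hdV dW hdW)] [BorelSpace (unipDelta L e dV hdV dW hdW)]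

set_option maxHeartbeats 400000 in
-- the final `refine hothers …` unifies the `set`-abbreviated orbit sum against the hypothesis' explicit form (as in the ★ parent)
include hwq in
/-- **THE MIDDLE TERM CONCENTRATES ON THE ORBIT OF `q₀`** when every other middle orbit dies: `MID_S = Σ'_{q ∈ O(q₀)} J_S(q)` (any index `S`; `q₀ ∈ REST`).
[cite: KudlaRallis1994, §2] [cite: MoeglinWaldspurger1995, II.1.7] -/
theorem integral_rest_eq_tsum_orbit (hdV0 : ∀ i, dV i ≠ 0) (hdW0 : ∀ i, dW i ≠ 0) (νN : Measure (unipDelta L e dV hdV dW hdW)) [νN.IsMulLeftInvariant]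
    {β : unipDelta L e dV hdV dW hdW → ℝ≥0∞} (hβ : IsCoveringWeight (unipDeltaRat L e dV hdV dW hdW) β)
    {f : HA L e dV hdV dW hdW → ℂ} (hfc : Continuous f)
    (h : HA L e dV hdV dW hdW)
    (hH : ∫⁻ u, (∑' q : SiegelDeltaQuot L e dV hdV dW hdW,
        ‖f ((((Quotient.out q : ratH L e dV hdV dW hdW) : HA L e dV hdV dW hdW)) * ((u : HA L e dV hdV dW hdW) * h))‖ₑ) * β u ∂νN ≠ ∞)
    (S : Matrix (Fin n) (Fin n) L) {q₀ : SiegelDeltaQuot L e dV hdV dW hdW}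
    (hq₀ : q₀ ∈ (({Quotient.mk (MulAction.orbitRel (siegelDeltaRat L e dV hdV dW hdW) (ratH L e dV hdV dW hdW)) 1} ∪
        Set.range (fun ν : unipDeltaRat L e dV hdV dW hdW =>
          (Quotient.mk (MulAction.orbitRel (siegelDeltaRat L e dV hdV dW hdW) (ratH L e dV hdV dW hdW)) (wq ν) :
            SiegelDeltaQuot L e dV hdV dW hdW)))ᶜ : Set (SiegelDeltaQuot L e dV hdV dW hdW)))
    (hothers : ∀ (g : UnitaryGroup.rationalPair (Fp L) L (IsCMField.complexConj L) N M (Matrix.diagonal dV) (Matrix.diagonal dW)) (χ : Fin n → L)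
      (p' : HA L e dV hdV dW hdW), (∀ k, χ k = 0 ∨ χ k = 1) → (∃ k, χ k = 0) →
      ((g : GL (Fin N × Fin M) L) : Matrix (Fin N × Fin M) (Fin N × Fin M) L) = Matrix.diagonal (fun k => 1 - 2 * χ (e k)) → g * g = 1 →
      p' ∈ ratH L e dV hdV dW hdW → IsSiegelDelta L e dV hdV dW hdW p' →
      ∀ (hγ₀ : iotaGG L e dV hdV dW hdW (1, UnitaryGroup.rationalPairToAdelic (Fp L) L (IsCMField.complexConj L) N M (Matrix.diagonal dV) (Matrix.diagonal dW) g) * p' ∈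
        ratH L e dV hdV dW hdW),
      Set.range (fun ν : unipDeltaRat L e dV hdV dW hdW =>
        (Quotient.mk (MulAction.orbitRel (siegelDeltaRat L e dV hdV dW hdW) (ratH L e dV hdV dW hdW))
          ((⟨_, hγ₀⟩ : ratH L e dV hdV dW hdW) * ⟨(((ν) : unipDelta L e dV hdV dW hdW) : HA L e dV hdV dW hdW), coe_mem_ratH (ν)⟩) : SiegelDeltaQuot L e dV hdV dW hdW)) ≠
      Set.range (fun ν : unipDeltaRat L e dV hdV dW hdW =>
        (Quotient.mk (MulAction.orbitRel (siegelDeltaRat L e dV hdV dW hdW) (ratH L e dV hdV dW hdW)) ((Quotient.out q₀ : ratH L e dV hdV dW hdW) * ⟨(((ν) : unipDelta L e dV hdV dW hdW) : HA L e dV hdV dW hdW), coe_mem_ratH (ν)⟩) : SiegelDeltaQuot L e dV hdV dW hdW)) →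
      (∫⁻ u, (∑' q : ↥(Set.range (fun ν : unipDeltaRat L e dV hdV dW hdW =>
            (Quotient.mk (MulAction.orbitRel (siegelDeltaRat L e dV hdV dW hdW) (ratH L e dV hdV dW hdW))
              ((⟨_, hγ₀⟩ : ratH L e dV hdV dW hdW) * ⟨((ν : unipDelta L e dV hdV dW hdW) : HA L e dV hdV dW hdW), coe_mem_ratH ν⟩)))),
          ‖f (((Quotient.out q.1 : ratH L e dV hdV dW hdW) : HA L e dV hdV dW hdW) * ((u : HA L e dV hdV dW hdW) * h))‖ₑ) * β u ∂νN ≠ ∞) →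
      ∑' q : ↥(Set.range (fun ν : unipDeltaRat L e dV hdV dW hdW =>
            (Quotient.mk (MulAction.orbitRel (siegelDeltaRat L e dV hdV dW hdW) (ratH L e dV hdV dW hdW))
              ((⟨_, hγ₀⟩ : ratH L e dV hdV dW hdW) * ⟨((ν : unipDelta L e dV hdV dW hdW) : HA L e dV hdV dW hdW), coe_mem_ratH ν⟩)))),
        ∫ u, (β u).toReal • (conj (unipDeltaChar L e dV hdV dW hdW S (u : HA L e dV hdV dW hdW) : ℂ) *
          f (((Quotient.out q.1 : ratH L e dV hdV dW hdW) : HA L e dV hdV dW hdW) * ((u : HA L e dV hdV dW hdW) * h))) ∂νN = 0) :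
    ∫ u, (β u).toReal • (conj (unipDeltaChar L e dV hdV dW hdW S (u : HA L e dV hdV dW hdW) : ℂ) *
      (∑' q : ↥(({Quotient.mk (MulAction.orbitRel (siegelDeltaRat L e dV hdV dW hdW) (ratH L e dV hdV dW hdW)) 1} ∪
        Set.range (fun ν : unipDeltaRat L e dV hdV dW hdW =>
          (Quotient.mk (MulAction.orbitRel (siegelDeltaRat L e dV hdV dW hdW) (ratH L e dV hdV dW hdW)) (wq ν) :
            SiegelDeltaQuot L e dV hdV dW hdW)))ᶜ : Set (SiegelDeltaQuot L e dV hdV dW hdW)),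
      f ((((Quotient.out (q : SiegelDeltaQuot L e dV hdV dW hdW) : ratH L e dV hdV dW hdW) : HA L e dV hdV dW hdW)) *
        ((u : HA L e dV hdV dW hdW) * h)))) ∂νN =
      ∑' q : ↥(Set.range (fun ν : unipDeltaRat L e dV hdV dW hdW =>
        (Quotient.mk (MulAction.orbitRel (siegelDeltaRat L e dV hdV dW hdW) (ratH L e dV hdV dW hdW)) ((Quotient.out q₀ : ratH L e dV hdV dW hdW) * ⟨(((ν) : unipDelta L e dV hdV dW hdW) : HA L e dV hdV dW hdW), coe_mem_ratH (ν)⟩) : SiegelDeltaQuot L e dV hdV dW hdW))),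
        ∫ u, (β u).toReal • (conj (unipDeltaChar L e dV hdV dW hdW S (u : HA L e dV hdV dW hdW) : ℂ) *
          f (((Quotient.out q.1 : ratH L e dV hdV dW hdW) : HA L e dV hdV dW hdW) * ((u : HA L e dV hdV dW hdW) * h))) ∂νN := by
  classical
  haveI : Countable (unipDeltaRat L e dV hdV dW hdW) := countable_unipDeltaRat L e dV hdV dW hdW
  haveI : Countable (ratH L e dV hdV dW hdW) := countable_ratH L e dV hdV dW hdW
  haveI : Countable (SiegelDeltaQuot L e dV hdV dW hdW) := by unfold SiegelDeltaQuot; exact inferInstance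
  -- notation
  set mk : ratH L e dV hdV dW hdW → SiegelDeltaQuot L e dV hdV dW hdW :=
    Quotient.mk (MulAction.orbitRel (siegelDeltaRat L e dV hdV dW hdW) (ratH L e dV hdV dW hdW)) with hmk
  set R : Set (SiegelDeltaQuot L e dV hdV dW hdW) := ({mk 1} ∪ Set.range (fun ν : unipDeltaRat L e dV hdV dW hdW => mk (wq ν)))ᶜ with hR
  set orb : SiegelDeltaQuot L e dV hdV dW hdW → Set (SiegelDeltaQuot L e dV hdV dW hdW) := fun q =>
    Set.range (fun ν : unipDeltaRat L e dV hdV dW hdW =>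
      mk ((Quotient.out q : ratH L e dV hdV dW hdW) * ⟨((ν : unipDelta L e dV hdV dW hdW) : HA L e dV hdV dW hdW), coe_mem_ratH ν⟩)) with horb
  let J : SiegelDeltaQuot L e dV hdV dW hdW → ℂ := fun q =>
    ∫ u, (β u).toReal • (conj (unipDeltaChar L e dV hdV dW hdW S (u : HA L e dV hdV dW hdW) : ℂ) *
      f ((((Quotient.out q : ratH L e dV hdV dW hdW) : HA L e dV hdV dW hdW)) * ((u : HA L e dV hdV dW hdW) * h))) ∂νN
  -- Step 1: Fubini for series under (H)
  have hgm : ∀ q : SiegelDeltaQuot L e dV hdV dW hdW, AEStronglyMeasurable (fun u : unipDelta L e dV hdV dW hdW =>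
      (β u).toReal • (conj (unipDeltaChar L e dV hdV dW hdW S (u : HA L e dV hdV dW hdW) : ℂ) *
        f ((((Quotient.out q : ratH L e dV hdV dW hdW) : HA L e dV hdV dW hdW)) * ((u : HA L e dV hdV dW hdW) * h)))) νN :=
    fun q => aestronglyMeasurable_wt_smul_conj_mul_apply νN hβ.1 S hfc _ h
  have hsum : ∑' q : SiegelDeltaQuot L e dV hdV dW hdW, ∫⁻ u, ‖(β u).toReal • (conj (unipDeltaChar L e dV hdV dW hdW S (u : HA L e dV hdV dW hdW) : ℂ) *
      f ((((Quotient.out q : ratH L e dV hdV dW hdW) : HA L e dV hdV dW hdW)) * ((u : HA L e dV hdV dW hdW) * h)))‖ₑ ∂νN ≠ ∞ := by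
    simp_rw [enorm_wt_smul_conj_mul hβ S]
    rw [← lintegral_tsum (f := fun (q : SiegelDeltaQuot L e dV hdV dW hdW) (u : unipDelta L e dV hdV dW hdW) =>
        ‖f ((((Quotient.out q : ratH L e dV hdV dW hdW) : HA L e dV hdV dW hdW)) * ((u : HA L e dV hdV dW hdW) * h))‖ₑ * β u)
      fun q => ((measurable_enorm_apply_mul_coe_mul' hfc _ h).mul hβ.1).aemeasurable]
    simp_rw [ENNReal.tsum_mul_right]
    exact hH
  have hsumR : ∑' q : ↥R, ∫⁻ u, ‖(β u).toReal • (conj (unipDeltaChar L e dV hdV dW hdW S (u : HA L e dV hdV dW hdW) : ℂ) *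
      f ((((Quotient.out (q : SiegelDeltaQuot L e dV hdV dW hdW) : ratH L e dV hdV dW hdW) : HA L e dV hdV dW hdW)) * ((u : HA L e dV hdV dW hdW) * h)))‖ₑ ∂νN ≠ ∞ :=
    ne_top_of_le_ne_top hsum (ENNReal.tsum_comp_le_tsum_of_injective Subtype.val_injective _)
  have h1 : ∫ u, (β u).toReal • (conj (unipDeltaChar L e dV hdV dW hdW S (u : HA L e dV hdV dW hdW) : ℂ) *
      (∑' q : ↥R, f ((((Quotient.out (q : SiegelDeltaQuot L e dV hdV dW hdW) : ratH L e dV hdV dW hdW) : HA L e dV hdV dW hdW)) *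
        ((u : HA L e dV hdV dW hdW) * h)))) ∂νN = ∑' q : ↥R, J q := by
    show _ = ∑' q : ↥R, ∫ u, (β u).toReal • (conj (unipDeltaChar L e dV hdV dW hdW S (u : HA L e dV hdV dW hdW) : ℂ) *
      f ((((Quotient.out (q : SiegelDeltaQuot L e dV hdV dW hdW) : ratH L e dV hdV dW hdW) : HA L e dV hdV dW hdW)) * ((u : HA L e dV hdV dW hdW) * h))) ∂νN
    rw [← integral_tsum (fun q : ↥R => hgm q) hsumR]
    refine integral_congr_ae (ae_of_all _ fun u => ?_)
    show (β u).toReal • (conj (unipDeltaChar L e dV hdV dW hdW S (u : HA L e dV hdV dW hdW) : ℂ) *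
      (∑' q : ↥R, f ((((Quotient.out (q : SiegelDeltaQuot L e dV hdV dW hdW) : ratH L e dV hdV dW hdW) : HA L e dV hdV dW hdW)) *
        ((u : HA L e dV hdV dW hdW) * h)))) =
      ∑' q : ↥R, (β u).toReal • (conj (unipDeltaChar L e dV hdV dW hdW S (u : HA L e dV hdV dW hdW) : ℂ) *
        f ((((Quotient.out (q : SiegelDeltaQuot L e dV hdV dW hdW) : ratH L e dV hdV dW hdW) : HA L e dV hdV dW hdW)) * ((u : HA L e dV hdV dW hdW) * h)))
    rw [tsum_const_smul'' (β u).toReal, tsum_mul_left]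
  change (∫ u, (β u).toReal • (conj (unipDeltaChar L e dV hdV dW hdW S (u : HA L e dV hdV dW hdW) : ℂ) *
      (∑' q : ↥R, f ((((Quotient.out (q : SiegelDeltaQuot L e dV hdV dW hdW) : ratH L e dV hdV dW hdW) : HA L e dV hdV dW hdW)) *
        ((u : HA L e dV hdV dW hdW) * h)))) ∂νN) = ∑' q : ↥(orb q₀), J q.1
  rw [h1]
  -- Step 2: `J` is absolutely summable
  have hJs : Summable J := by
    refine Summable.of_norm_bounded (ENNReal.summable_toReal hsum) fun q => ?_
    rw [← toReal_enorm (J q)]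
    exact ENNReal.toReal_mono (ENNReal.ne_top_of_tsum_ne_top hsum q) (enorm_integral_le_lintegral_enorm _)
  -- Step 3: regroup REST along the fibres of `q ↦ O(q)`
  have hRorb : ∀ q : ↥R, orb q ⊆ R := fun q => orbit_subset_rest wq hwq q.2
  let π : ↥R → ↥(Set.range (fun q : ↥R => orb q)) := fun q => ⟨orb q, q, rfl⟩
  have hreg : ∑' q : ↥R, J q = ∑' ω : ↥(Set.range (fun q : ↥R => orb q)), ∑' c : {q : ↥R // π q = ω}, J c.1 := by
    rw [← (Equiv.sigmaFiberEquiv π).tsum_eq (fun q : ↥R => J q)]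
    have hS : Summable ((fun q : ↥R => J (q : SiegelDeltaQuot L e dV hdV dW hdW)) ∘ (Equiv.sigmaFiberEquiv π)) :=
      (Equiv.summable_iff _).2 (hJs.subtype R)
    exact hS.tsum_sigma' fun ω => ((hJs.subtype R).comp_injective (i := fun c : {q : ↥R // π q = ω} => c.1) fun a b hab => Subtype.ext hab)
  rw [hreg]
  -- Step 4: the outer sum has a single (possibly) non-zero term, the orbit of `q₀`
  let ω₀ : ↥(Set.range (fun q : ↥R => orb q)) := ⟨orb q₀, ⟨q₀, hq₀⟩, rfl⟩
  have hfibre : ∀ (ω : ↥(Set.range (fun q : ↥R => orb q))) (q₁ : ↥R), orb q₁ = ω.1 →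
      ∑' c : {q : ↥R // π q = ω}, J c.1 = ∑' x : ↥(orb q₁), J x.1 := by
    intro ω q₁ hq₁'
  -- the fibre over `ω` is the orbit `O(q₁)`
    have hfib : ∀ x : SiegelDeltaQuot L e dV hdV dW hdW, x ∈ orb q₁ ↔ ∃ hx : x ∈ R, π ⟨x, hx⟩ = ω := by
      intro x
      constructor
      · intro hx
        exact ⟨hRorb q₁ hx, Subtype.ext ((orbit_eq_of_mem hx).trans hq₁')⟩
      · rintro ⟨hxR, hx⟩
        have h1 : orb x = orb q₁ := (congrArg Subtype.val hx).trans hq₁'.symm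
        rw [← h1]
        exact orbit_mem x
    let eω : {q : ↥R // π q = ω} ≃ ↥(orb q₁) :=
      { toFun := fun c => ⟨c.1.1, (hfib c.1.1).2 ⟨c.1.2, c.2⟩⟩
        invFun := fun x => ⟨⟨x.1, ((hfib x.1).1 x.2).choose⟩, ((hfib x.1).1 x.2).choose_spec⟩
        left_inv := fun c => Subtype.ext (Subtype.ext rfl)
        right_inv := fun x => Subtype.ext rfl }
    have hsumω : ∑' c : {q : ↥R // π q = ω}, J c.1 = ∑' x : ↥(orb q₁), J x.1 :=
      calc ∑' c : {q : ↥R // π q = ω}, J c.1 = ∑' c : {q : ↥R // π q = ω}, J (eω c).1 := rfl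
        _ = ∑' x : ↥(orb q₁), J x.1 := eω.tsum_eq (fun x : ↥(orb (q₁ : SiegelDeltaQuot L e dV hdV dW hdW)) => J x.1)
    exact hsumω
  rw [tsum_eq_single ω₀]
  · exact hfibre ω₀ ⟨q₀, hq₀⟩ rfl
  intro ω hne
  obtain ⟨q₁, hq₁⟩ := ω.2
  have hq₁' : orb q₁ = ω.1 := hq₁
  rw [hfibre ω q₁ hq₁']
  have hneorb : orb q₁ ≠ orb q₀ := by
    intro h'; apply hne; apply Subtype.ext; rw [← hq₁', h']
  -- the representative `γ_q₁` is off `P_Δ` and off the big cell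
  have hq₁R : (q₁ : SiegelDeltaQuot L e dV hdV dW hdW) ∉ ({mk 1} ∪ Set.range (fun ν : unipDeltaRat L e dV hdV dW hdW => mk (wq ν))) := q₁.2
  simp only [Set.mem_union, Set.mem_singleton_iff, Set.mem_range, not_or, not_exists] at hq₁R
  have hnbig : ¬ IsUnit (Matrix.fromBlocks (1 : Matrix (Fin n) (Fin n) (AdeleRing (𝓞 L) L)) 0 (-1) 1 *
      blk L e dV hdV dW hdW ((Quotient.out (q₁ : SiegelDeltaQuot L e dV hdV dW hdW) : ratH L e dV hdV dW hdW) : HA L e dV hdV dW hdW) *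
        Matrix.fromBlocks 1 0 1 1).toBlocks₂₁.det := by
    intro hu
    obtain ⟨p, ν, hpr, hpP, hνN, hνr, hγe⟩ := exists_rat_siegel_weylDelta_unip L e dV hdV dW hdW hdV0 hdW0
      ((Quotient.out (q₁ : SiegelDeltaQuot L e dV hdV dW hdW) : ratH L e dV hdV dW hdW)).2 hu
    refine hq₁R.2 ⟨⟨ν, hνN⟩, (mem_unipDeltaRat_iff L e dV hdV dW hdW _).2 hνr⟩ ?_
    refine ((mk_eq_mk_iff_isSiegelDelta _ _).2 ?_).trans (Quotient.out_eq (q₁ : SiegelDeltaQuot L e dV hdV dW hdW))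
    rw [hγe, hwq]
    show IsSiegelDelta L e dV hdV dW hdW (p * weylDelta L e dV hdV dW hdW * ν * (weylDelta L e dV hdV dW hdW * ν)⁻¹)
    simp only [mul_inv_rev, mul_assoc, mul_inv_cancel_left, mul_inv_cancel, mul_one]
    exact hpP
  obtain ⟨g, χ, p, p', hχ, ⟨k₀, hk₀⟩, hg, hgg, hpr, hpP, hp'r, hp'P, hγeq⟩ :=
    exists_siegel_mul_refl_mul_siegel L e dV hdV dW hdW hdV0 hdW0 ((Quotient.out (q₁ : SiegelDeltaQuot L e dV hdV dW hdW) : ratH L e dV hdV dW hdW)).2 hnbig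
  have hγ₀ : iotaGG L e dV hdV dW hdW (1, UnitaryGroup.rationalPairToAdelic (Fp L) L (IsCMField.complexConj L) N M (Matrix.diagonal dV) (Matrix.diagonal dW) g) * p' ∈
      ratH L e dV hdV dW hdW := mul_mem (iotaGG_one_mem_ratH L e dV hdV dW hdW g) hp'r
  -- the orbit of `q₁` is `O(w_χ p')`
  have horb : orb q₁ = Set.range (fun ν : unipDeltaRat L e dV hdV dW hdW =>
      Quotient.mk (MulAction.orbitRel (siegelDeltaRat L e dV hdV dW hdW) (ratH L e dV hdV dW hdW)) ((⟨_, hγ₀⟩ : ratH L e dV hdV dW hdW) * (⟨(((ν) : unipDelta L e dV hdV dW hdW) : HA L e dV hdV dW hdW), coe_mem_ratH (ν)⟩ : ratH L e dV hdV dW hdW))) := by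
    refine Set.ext fun x => ⟨?_, ?_⟩
    · rintro ⟨ν, rfl⟩
      refine ⟨ν, (mk_mul_right_iff _ _ _).2 ((mk_eq_mk_iff_isSiegelDelta _ _).2 ?_)⟩
      show IsSiegelDelta L e dV hdV dW hdW ((((Quotient.out (q₁ : SiegelDeltaQuot L e dV hdV dW hdW) : ratH L e dV hdV dW hdW) : HA L e dV hdV dW hdW)) *
        (iotaGG L e dV hdV dW hdW (1, UnitaryGroup.rationalPairToAdelic (Fp L) L (IsCMField.complexConj L) N M (Matrix.diagonal dV) (Matrix.diagonal dW) g) * p')⁻¹)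
      rw [hγeq]
      simp only [mul_inv_rev, mul_assoc, mul_inv_cancel_left, mul_inv_cancel, mul_one]
      exact hpP
    · rintro ⟨ν, rfl⟩
      refine ⟨ν, (mk_mul_right_iff _ _ _).2 ((mk_eq_mk_iff_isSiegelDelta _ _).2 ?_)⟩
      show IsSiegelDelta L e dV hdV dW hdW
        (iotaGG L e dV hdV dW hdW (1, UnitaryGroup.rationalPairToAdelic (Fp L) L (IsCMField.complexConj L) N M (Matrix.diagonal dV) (Matrix.diagonal dW) g) * p' *
          ((((Quotient.out (q₁ : SiegelDeltaQuot L e dV hdV dW hdW) : ratH L e dV hdV dW hdW) : HA L e dV hdV dW hdW)))⁻¹)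
      rw [hγeq]
      simp only [mul_inv_rev, mul_assoc, mul_inv_cancel_left]
      exact isSiegelDelta_inv L e dV hdV dW hdW hpP
  rw [tsum_congr_set_coe (fun x => J x) horb]
  -- integrability of the orbit from (H), and the orbit hypothesis
  refine hothers g χ p' hχ ⟨k₀, hk₀⟩ hg hgg hp'r hp'P hγ₀ (by rw [← horb]; exact hneorb) ?_
  refine ne_top_of_le_ne_top hH (lintegral_mono fun u => mul_le_mul' ?_ le_rfl)
  exact ENNReal.tsum_comp_le_tsum_of_injective Subtype.val_injective
    (fun q : SiegelDeltaQuot L e dV hdV dW hdW => ‖f ((((Quotient.out q : ratH L e dV hdV dW hdW) : HA L e dV hdV dW hdW)) * ((u : HA L e dV hdV dW hdW) * h))‖ₑ)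


end Rest

end Summit.HodgeConjecture.HodgeConjecture.Cruxes.HLiu418.K2LiuSiegelEisensteinCoeffSingleOrbit

end
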